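import Summits.ABC.IUTFork.Charitable.Thm311D1PerPlaceSeparation
import Summits.ABC.IUTFork.Charitable.Thm311D1PerPlaceSepSignKit
import HarnessLib

/-!
# Branch D, team D1 — per-place ⊊ uniform INSIDE THE SUB-PACKETS: a pure (Ind2) separating datum (answer to attack (α) on p435474)

Record file (D-0012; abc-iut cell, rung LADDER-ABC:A2.D; abc-iut-D1-prv gen 2). TAKES NO SIDE on [IUTchIII] Cor. 3.12 or on any author;
NO `Prop` fact; new MODEL DATA = one q-datum (`sepDatumSub`); everything else is a theorem. Kits: `Thm311D1PerPlaceSepKit` (p434785),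
`Thm311D1PerPlaceSepSignKit`; model `idSetting` of `Thm311D1PerPlaceSeparation` (p435474).

ATTACK (α) on p435474 (posted by this seat 09:2xZ for D1-cx): its separating q-datum is the (Ind1) capsule SWAP of `Ψ_v`, which moves the
`α = j` tensor factor off the summand `v`, so the datum leaves the sub-packet `∏_j 𝓘^ℚ(^{S^±_{j+1},j};𝒟⊢_v)` in which print places the
splitting monoids ([IUTchIII] Thm. 3.11 (i) (b), S. Mochizuki, *Inter-universal Teichmüller theory III*, kurims (May 2020) p. 154: «as a subset
of ∏_{j∈𝔽_l^⋇} 𝓘^ℚ(^{S^±_{j+1},j};ⁿ’°𝒟⊢_v)»). ANSWER (kernel): the separation survives with a PURE (Ind2) datum that STAYS in the sub-packets.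
THE MODEL: any skeleton with two distinct bad places `v ≠ v′` over one rational place; sign shells + `NaiveProv.full1`; `idSetting` (identified
volumes, forced by `not_perPlace_of_qPinned_pinnedSetting`); operator of record `NaiveProv.orbitRegion`; q-datum `sepDatumSub` := at `v` the
transport of `Ψ_v` by `negSummandFamily v′` — «independent copies of Ism» acting by `−1` on the direct summand `v′` of the tensor factor `0`
and trivially elsewhere ((Ind2), p. 154) —, at every other bad place `Ψ` itself. Every element of the datum lies in the sub-packets
(`sepDatumSub_subPacket`).
CERTIFICATE (`perPlace_separation_sub`, closed instance `perPlace_separation_sub_instance`): per-place square ∧ (ii)(b) ∧ PinnedRegions3 ∧ S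
HOLD, the uniform square `PilotKummerCompat` and `IndPatch` FAIL. WHY (the content of the separation): the data at `v` and at `v′` live in
the SAME packet at `v_ℚ` and their one-factor theta vectors SHARE the non-`α` tensor factors (all-ones vectors on `⊕_{w∣v_ℚ} ℚ`); a single
element of ⟨(Ind1)∪(Ind2)⟩ acts there with ONE separable sign (`sepSignedAt_of_mem_closure`), so it cannot flip the `v′`-summand of factor
`0` relative to the `v`-summand in `v`'s datum while fixing `Ψ_{v′}` (`sign_ratio` twice: `e₀(v) = e₀(v′)` and `e₀(v′) = −e₀(v)`).
READING (numbers, not adjectives): even for data inside print's sub-packets, the uniform clause both blind teams typed is strictly stronger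
than the per-place square under the three pins, and S needs only the latter at placewise-invariant operators (p431983); both are
datum-level readings above the sense print fixes for (iii)(c) (Rmk. 3.11.4 (i), p. 172 l. 34–41). [claim: Mochizuki2012, status: disputed]
[cite: ScholzeStix2018, §2.2 pp. 9–10] Standard axioms; typed ≠ proved.
-/

noncomputable section

open Set

namespace Summit.ABC.IUTFork.Charitable

open Thm311 Cor312 Cor312Vol Literature.IUT.LogThetaLattice

variable {T : ThetaIndex}

/-! ## 1. The sub-packet-respecting separating datum; pins; per-place square; S -/

section Model

variable (p : ℕ) (v v' : T.V) (hv : v ∈ T.Vbad) (c : ℝ)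

open scoped Classical in
/-- **The separating q-datum inside the sub-packets**: at the bad place `v` the transport of `Ψ_v` by the (Ind2)-family `negSummandFamily v′`
(sign `−1` on the summand `v′` of the tensor factor `0`), at every other bad place `Ψ` itself. MODEL DATA. [folklore] -/
def sepDatumSub : ∀ w : T.V, w ∈ T.Vbad → Set ((NaiveProv.signShells T).StarPacket w) := fun w _ =>
  if w = v then (NaiveProv.signShells T).starAut (negSummandFamily v') w '' NaiveProv.PsiOf (NaiveProv.thetaVec1 p) w
  else NaiveProv.PsiOf (NaiveProv.thetaVec1 p) w

open scoped Classical in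
/-- The per-place indeterminacies realising the datum: `negSummandFamily v′` at `v`, the identity elsewhere. [folklore] -/
theorem sepDatumSub_eq : sepDatumSub p v v' = fun w _ =>
    (NaiveProv.signShells T).starAut (if w = v then negSummandFamily v' else 1) w ''
      NaiveProv.PsiOf (NaiveProv.thetaVec1 p) w := by
  funext w _
  unfold sepDatumSub
  split_ifs with h
  · rfl
  · rw [starAut_one_image]

/-- **The datum lies in the sub-packets** `∏_{j ∈ 𝔽_l^⋇} 𝓘^ℚ(^{S^±_{j+1},j};𝒟⊢_w)` at every bad place `w` (Thm. 3.11 (i) (b) placement; the sign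
family preserves the support of the `α = j` factor). [folklore] -/
theorem sepDatumSub_subPacket (w : T.V) (hw : w ∈ T.Vbad) {f : (NaiveProv.signShells T).StarPacket w}
    (hf : f ∈ sepDatumSub p v v' w hw) (j : T.LabelStar) : f j ∈ (NaiveProv.signShells T).SubPacket j.1 w := by
  classical
  unfold sepDatumSub at hf
  split_ifs at hf with h
  · subst h
    obtain ⟨g, hg, rfl⟩ := hf
    have happ : ((NaiveProv.signShells T).starAut (negSummandFamily v') w g) j =
        negSummandFamily v' j.1 (T.over w) (g j) := by
      simp [LogShells.starAut]
    rw [happ]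
    rcases hg j with h1 | h1
    · rw [h1]; exact negSummandFamily_thetaVec1_mem_subPacket p v' w j.1
    · rw [h1, map_neg]; exact Submodule.neg_mem _ (negSummandFamily_thetaVec1_mem_subPacket p v' w j.1)
  · exact NaiveProv.PsiOf_subPacket _ w (fun j => NaiveProv.thetaVec1_mem_subPacket p w j.1) hf j

/-- **The per-place square HOLDS** for the datum (row `m = 0`: the column's Kummer image is `Ψ`, Part II `NaiveProv.full1_frobΨ`). [folklore] -/
theorem sepDatumSub_perPlace :
    PerPlaceKummerCompat (NaiveProv.full1 p (T.over v) c).toLatticeSituation (idSetting p v hv c) (sepDatumSub p v v') := by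
  classical
  intro w hw
  have hΨ := NaiveProv.full1_frobΨ p (T.over v) c (idSetting p v hv c).n 0
  refine ⟨if w = v then negSummandFamily v' else 1, ?_, 0, ?_⟩
  · split_ifs
    · exact negSummandFamily_mem_closure v'
    · exact one_mem _
  · rw [hΨ, sepDatumSub_eq]

variable [hp : Fact p.Prime]

/-- **(pq′) holds** for the datum at identified volumes (placewise invariance of the operator, then `NaiveProv.orbitRegion_Psi`). [folklore] -/
theorem idSetting_qPinned_sepDatumSub :
    QPinned (NaiveProv.full1 p (T.over v) c).toLatticeSituation (idSetting p v hv c) (NaiveProv.orbitRegion p)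
      (sepDatumSub p v v') := fun j vQ => by
  classical
  rw [idSetting_qRegion, sepDatumSub_eq,
    placewiseIndInvariant_orbitRegion p (T.over v) c (fun w _ => if w = v then negSummandFamily v' else 1) (fun w _ => by
      split_ifs
      · exact negSummandFamily_mem_closure v'
      · exact one_mem _),
    NaiveProv.orbitRegion_Psi]

/-- **All three pins hold** at (`idSetting`, `orbitRegion`, `sepDatumSub`). [folklore] -/
theorem idSetting_pinnedRegions3_sepDatumSub :
    PinnedRegions3 (NaiveProv.full1 p (T.over v) c).toLatticeSituation (idSetting p v hv c) (NaiveProv.orbitRegion p)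
      (sepDatumSub p v v') :=
  ⟨⟨idSetting_thetaPinned p v hv c, idSetting_qPinned_sepDatumSub p v v' hv c⟩, idSetting_pilotLink p v hv c⟩

/-- **S HOLDS** for the datum (per-place square + placewise invariance, p431983). [folklore] -/
theorem sepDatumSub_S :
    PilotKummerIndRelated (NaiveProv.full1 p (T.over v) c).toLatticeSituation (idSetting p v hv c)
      (NaiveProv.orbitRegion p) (sepDatumSub p v v') :=
  S_of_perPlace_of_placewiseInvariant _ _ _ _
    (GluedMonoids.kummerB_of_statement (NaiveProv.full1 p (T.over v) c) (NaiveProv.full1_statement p (T.over v) c) _)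
    (placewiseIndInvariant_orbitRegion p (T.over v) c) (sepDatumSub_perPlace p v v' hv c)

end Model

/-! ## 2. The separation inside the sub-packets -/

section Separation

variable (p : ℕ) [hp : Fact p.Prime]

omit hp in
/-- The one-factor theta vector read along «factor `0` at `b`, the rest at `u`» gives `q^{j²}` (`α = j ≠ 0` is read at `u`). [folklore] -/
theorem coordTuple_thetaVec1_tuple0 (u : T.V) (b : T.Fibre (T.over u)) (j : T.LabelStar) (hj : T.selfIndex j.1 ≠ 0) :
    coordTuple j.1 (T.over u) (fun i => if i = 0 then b else T.toFibre u) (NaiveProv.thetaVec1 p u j.1) =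
      (p : ℚ) ^ ((j.1 : ℕ) ^ 2) := by
  rw [coordTuple_thetaVec1, if_pos (by simp [hj])]

omit hp in
/-- … and its `negSummandFamily x`-transport read the same way gives `−q^{j²}` when `b` is the summand `x`. [folklore] -/
theorem coordTuple_neg_thetaVec1_tuple0 (x u : T.V) (b : T.Fibre (T.over u)) (hb : b.1 = x) (j : T.LabelStar)
    (hj : T.selfIndex j.1 ≠ 0) :
    coordTuple j.1 (T.over u) (fun i => if i = 0 then b else T.toFibre u)
      (negSummandFamily x j.1 (T.over u) (NaiveProv.thetaVec1 p u j.1)) = (-1) * (p : ℚ) ^ ((j.1 : ℕ) ^ 2) := by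
  rw [coordTuple_negSummandFamily, coordTuple_thetaVec1_tuple0 p u b j hj]
  simp [hb]

omit hp in
/-- … while read along «everything at `u`» (`u ≠ x`) it gives `q^{j²}`. [folklore] -/
theorem coordTuple_neg_thetaVec1_const (x u : T.V) (hux : u ≠ x) (j : T.LabelStar) :
    coordTuple j.1 (T.over u) (fun _ => T.toFibre u)
      (negSummandFamily x j.1 (T.over u) (NaiveProv.thetaVec1 p u j.1)) = 1 * (p : ℚ) ^ ((j.1 : ℕ) ^ 2) := by
  rw [coordTuple_negSummandFamily, coordTuple_thetaVec1, if_pos rfl]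
  simp [ThetaIndex.toFibre, hux]

/-- **Core: no single element of ⟨(Ind1)∪(Ind2)⟩ fixes `Ψ_{v′}` and realises `negSummandFamily v′` on `Ψ_v`** when `v ≠ v′` lie over one
rational place — `sign_ratio` at `v′` gives `e₀(v) = e₀(v′)`, at `v` gives `e₀(v′) = −e₀(v)`, for the separable sign of `Φ` at the label
`l⋆`. [folklore] -/
theorem no_uniform_of_fix_and_neg {Φ : (NaiveProv.signShells T).PacketAut}
    (hΦ : Φ ∈ Subgroup.closure ((NaiveProv.signShells T).Ind1Family ∪ (NaiveProv.signShells T).Ind2Family))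
    {v v' : T.V} (hne : v ≠ v') (hover : T.over v' = T.over v)
    (h1 : NaiveProv.PsiOf (NaiveProv.thetaVec1 p) v' =
      (NaiveProv.signShells T).starAut Φ v' '' NaiveProv.PsiOf (NaiveProv.thetaVec1 p) v')
    (h2 : (NaiveProv.signShells T).starAut (negSummandFamily v') v '' NaiveProv.PsiOf (NaiveProv.thetaVec1 p) v =
      (NaiveProv.signShells T).starAut Φ v '' NaiveProv.PsiOf (NaiveProv.thetaVec1 p) v) : False := by
  classical
  obtain ⟨τ, e, he, hτe⟩ := sepSignedAt_of_mem_closure hΦ (labelLast T).1 (T.over v)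
  have hτe' : ∀ (w : T.Caps (labelLast T).1 → T.Fibre (T.over v')) t,
      coordTuple (labelLast T).1 (T.over v') w (Φ (labelLast T).1 (T.over v') t) =
        (∏ i, e i (w i).1) * coordTuple (labelLast T).1 (T.over v') (fun i => w (τ i)) t := by
    rw [hover]; exact hτe
  have hz₁ : (⟨v, hover.symm⟩ : T.Fibre (T.over v')) ≠ T.toFibre v' := fun h => hne (congrArg Subtype.val h)
  have hz₂ : (⟨v', hover⟩ : T.Fibre (T.over v)) ≠ T.toFibre v := fun h => hne (congrArg Subtype.val h).symm
  have hself := selfIndex_labelLast_ne_zero T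
  -- `v′`-side: `Φ` fixes `Ψ_{v′}`
  obtain ⟨f', hf', hfeq'⟩ : NaiveProv.thetaTupleOf (NaiveProv.thetaVec1 p) v' ∈
      (NaiveProv.signShells T).starAut Φ v' '' NaiveProv.PsiOf (NaiveProv.thetaVec1 p) v' :=
    h1 ▸ NaiveProv.thetaTupleOf_mem_PsiOf _ v'
  have ht' : Φ (labelLast T).1 (T.over v') (f' (labelLast T)) = NaiveProv.thetaVec1 p v' (labelLast T).1 := by
    have := congrArg (fun g => g (labelLast T)) hfeq'
    simpa [LogShells.starAut, NaiveProv.thetaTupleOf] using this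
  have hcb' : coordTuple (labelLast T).1 (T.over v')
      (fun i => if i = 0 then (⟨v, hover.symm⟩ : T.Fibre (T.over v')) else T.toFibre v')
      (NaiveProv.thetaVec1 p v' (labelLast T).1) = 1 * (p : ℚ) ^ (((labelLast T).1 : ℕ) ^ 2) := by
    rw [coordTuple_thetaVec1, if_pos (by simp [hself]), one_mul]
  have hca' : coordTuple (labelLast T).1 (T.over v') (fun _ => T.toFibre v')
      (NaiveProv.thetaVec1 p v' (labelLast T).1) = 1 * (p : ℚ) ^ (((labelLast T).1 : ℕ) ^ 2) := by
    rw [coordTuple_thetaVec1, if_pos rfl, one_mul]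
  have hi := sign_ratio p ⟨v, hover.symm⟩ hz₁ (labelLast T) hτe' hf' ht' one_ne_zero hcb' hca'
  -- `v`-side: `Φ` realises the sign flip on `Ψ_v`
  obtain ⟨f, hf, hfeq⟩ : (NaiveProv.signShells T).starAut (negSummandFamily v') v
      (NaiveProv.thetaTupleOf (NaiveProv.thetaVec1 p) v) ∈
      (NaiveProv.signShells T).starAut Φ v '' NaiveProv.PsiOf (NaiveProv.thetaVec1 p) v :=
    h2 ▸ ⟨_, NaiveProv.thetaTupleOf_mem_PsiOf _ v, rfl⟩
  have ht : Φ (labelLast T).1 (T.over v) (f (labelLast T)) =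
      negSummandFamily v' (labelLast T).1 (T.over v) (NaiveProv.thetaVec1 p v (labelLast T).1) := by
    have := congrArg (fun g => g (labelLast T)) hfeq
    simpa [LogShells.starAut, NaiveProv.thetaTupleOf] using this
  have hcb := coordTuple_neg_thetaVec1_tuple0 p v' v ⟨v', hover⟩ rfl (labelLast T) hself
  have hca := coordTuple_neg_thetaVec1_const p v' v hne (labelLast T)
  have hii := sign_ratio p ⟨v', hover⟩ hz₂ (labelLast T) hτe hf ht (by norm_num) hcb hca
  -- combine
  simp only [mul_one, mul_neg] at hi hii
  have hev := he 0 v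
  have h0 : e 0 v = 0 := by linarith
  rw [h0, abs_zero] at hev
  exact zero_ne_one hev

/-- **The uniform square FAILS for the sub-packet datum.** [folklore] -/
theorem sepDatumSub_not_pilotKummerCompat (c : ℝ) {v v' : T.V} (hv : v ∈ T.Vbad) (hv' : v' ∈ T.Vbad) (hne : v ≠ v')
    (hover : T.over v' = T.over v) :
    ¬ PilotKummerCompat (NaiveProv.full1 p (T.over v) c).toLatticeSituation (idSetting p v hv c) (sepDatumSub p v v') := by
  classical
  rintro ⟨Φ, hΦ, m, hm⟩
  have hΨ := NaiveProv.full1_frobΨ p (T.over v) c (idSetting p v hv c).n m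
  have h1 : NaiveProv.PsiOf (NaiveProv.thetaVec1 p) v' =
      (NaiveProv.signShells T).starAut Φ v' '' NaiveProv.PsiOf (NaiveProv.thetaVec1 p) v' := by
    have := hm v' hv'
    rw [hΨ] at this
    simpa [sepDatumSub, hne.symm] using this
  have h2 : (NaiveProv.signShells T).starAut (negSummandFamily v') v '' NaiveProv.PsiOf (NaiveProv.thetaVec1 p) v =
      (NaiveProv.signShells T).starAut Φ v '' NaiveProv.PsiOf (NaiveProv.thetaVec1 p) v := by
    have := hm v hv
    rw [hΨ] at this
    simpa [sepDatumSub] using this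
  exact no_uniform_of_fix_and_neg p hΦ hne hover h1 h2

/-- **THE SUB-PACKET SEPARATION CERTIFICATE.** Over ANY index skeleton with two distinct bad places `v ≠ v′` over one rational place, at
(sign shells, `NaiveProv.full1`, `idSetting`, `NaiveProv.orbitRegion`, `sepDatumSub`): the q-datum lies in the sub-packets at every bad place,
the PER-PLACE square, Thm. 3.11 (ii)(b), all THREE PINS and S HOLD, the UNIFORM square and `IndPatch` FAIL (`IndPatch`: p435474's
`sep_not_indPatch` by name). [claim: Mochizuki2012, status: disputed] -/
theorem perPlace_separation_sub (c : ℝ) {v v' : T.V} (hv : v ∈ T.Vbad) (hv' : v' ∈ T.Vbad) (hne : v ≠ v')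
    (hover : T.over v' = T.over v) :
    (∀ (w : T.V) (hw : w ∈ T.Vbad), ∀ f ∈ sepDatumSub p v v' w hw, ∀ j : T.LabelStar,
        f j ∈ (NaiveProv.signShells T).SubPacket j.1 w) ∧
    PerPlaceKummerCompat (NaiveProv.full1 p (T.over v) c).toLatticeSituation (idSetting p v hv c) (sepDatumSub p v v') ∧
    ((NaiveProv.full1 p (T.over v) c).toLatticeSituation.col (idSetting p v hv c).n).KummerB
      ((NaiveProv.full1 p (T.over v) c).toLatticeSituation.D (idSetting p v hv c).n) ∧
    PinnedRegions3 (NaiveProv.full1 p (T.over v) c).toLatticeSituation (idSetting p v hv c) (NaiveProv.orbitRegion p)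
      (sepDatumSub p v v') ∧
    PilotKummerIndRelated (NaiveProv.full1 p (T.over v) c).toLatticeSituation (idSetting p v hv c)
      (NaiveProv.orbitRegion p) (sepDatumSub p v v') ∧
    ¬ PilotKummerCompat (NaiveProv.full1 p (T.over v) c).toLatticeSituation (idSetting p v hv c) (sepDatumSub p v v') ∧
    ¬ IndPatch (NaiveProv.full1 p (T.over v) c).toLatticeSituation :=
  ⟨fun w hw _ hf j => sepDatumSub_subPacket p v v' w hw hf j, sepDatumSub_perPlace p v v' hv c,
    GluedMonoids.kummerB_of_statement (NaiveProv.full1 p (T.over v) c) (NaiveProv.full1_statement p (T.over v) c) _,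
    idSetting_pinnedRegions3_sepDatumSub p v v' hv c, sepDatumSub_S p v v' hv c,
    sepDatumSub_not_pilotKummerCompat p c hv hv' hne hover, sep_not_indPatch p c hv hv' hne hover⟩

end Separation

/-! ## 3. Closed instance -/

/-- **Closed (binder-free) form** at `twoBadIndex` (`l⋆ = 2`, `𝕍 = 𝕍^bad = Bool` over `𝕍_ℚ = Unit`, `q = 2`, `c = 1`): a lattice situation,
setting, operator and q-datum INSIDE THE SUB-PACKETS at which the per-place square, (ii)(b), the three pins and S hold while the uniform square
and `IndPatch` fail. [claim: Mochizuki2012, status: disputed] -/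
theorem perPlace_separation_sub_instance :
    ∃ (T : ThetaIndex) (S : LatticeSituation T) (P : Cor312.Setting S.toSituation)
      (ρ : (∀ v : T.V, v ∈ T.Vbad → Set (S.L.StarPacket v)) → ∀ (j : T.Label) (vQ : T.VQ), Set (S.L.Packet j vQ))
      (qK : ∀ v : T.V, v ∈ T.Vbad → Set (S.L.StarPacket v)),
      (∀ (w : T.V) (hw : w ∈ T.Vbad), ∀ f ∈ qK w hw, ∀ j : T.LabelStar, f j ∈ S.L.SubPacket j.1 w) ∧
      PerPlaceKummerCompat S P qK ∧ (S.col P.n).KummerB (S.D P.n) ∧ PinnedRegions3 S P ρ qK ∧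
        PilotKummerIndRelated S P ρ qK ∧ ¬ PilotKummerCompat S P qK ∧ ¬ IndPatch S := by
  haveI : Fact (Nat.Prime 2) := ⟨Nat.prime_two⟩
  exact ⟨twoBadIndex, (NaiveProv.full1 2 (twoBadIndex.over true) 1).toLatticeSituation,
    idSetting (T := twoBadIndex) 2 true trivial 1, NaiveProv.orbitRegion 2, sepDatumSub (T := twoBadIndex) 2 true false,
    perPlace_separation_sub (T := twoBadIndex) 2 1 (v := true) (v' := false) trivial trivial
      (show (true : Bool) ≠ false by decide) rfl⟩

end Summit.ABC.IUTFork.Charitable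

end
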